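import Literature.Analysis.FluidPDE.AncientLimitVanishing
import Literature.Analysis.FluidPDE.TypeIRateOseenMildRepresentative
import Literature.Analysis.FluidPDE.OseenMildUniqueness
import Literature.Analysis.FluidPDE.LocalTypeI
import Literature.Analysis.FluidPDE.ESSLocalHolderBlowupLocalEnergy
import Literature.Analysis.FluidPDE.OseenMildWindowRepresentative
import Literature.Analysis.FluidPDE.CaloricLocalLerayLp
import HarnessLib

/-!
# Depth vorticity rigidity, part 2: the smooth depth representative and forward uniqueness up to
# the top time — helper for item `TerminalTrace.TypeITraceScarL3` (stmt-NavierStokesRegularity-18385),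
# stub QA of line `annulus-dichotomy`

Seat nsreg-C26-p1 (prover), `--supports stmt-NavierStokesRegularity-18385`; planner of record nsreg-p2
g28, ROUND-26 §1c (Q1).  Continues `TerminalTraceTypeITraceScarL3DepthVorticityRigidity.lean`.

* `exists_depth_representative` — a field suitable (Albritton–Barker Def. 2.1) in every `Q(a)`
  and essentially bounded on `]a − 1, b[ × ℝ³`, `b ≤ 0`, has on `]a, b[ × ℝ³` a jointly continuous
  representative with `C^∞` slices, all spatial derivatives jointly continuous, solving
  Navier–Stokes in the sense of distributions with the same pressure (Serrin's quantitative
  interior regularity `NSBoundedHigherRegularityBounds_holds` through the tree's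
  `exists_smooth_representative_of_locally_bounded` on `]a, b[ × B(0, n)`, the pressure bound being
  the LOCAL `L^{3/2}` class of Def. 2.1 — no uniform pressure hypothesis — and gluing of the local
  representatives, `exists_continuousOn_ae_eq_of_locally`).
* `ae_zero_to_top_of_slab_ae_zero` — FORWARD UNIQUENESS: if such a field, with `𝐈(ℝ³ × ℝ₋) < ∞`
  and bounded at every depth, vanishes a.e. on `]t₁, t₂[ × ℝ³` (`t₂ ≤ 0`), it vanishes a.e. on
  `]t₁, 0[ × ℝ³` (KNSS 2009 Lemma 3.1 / §4: the continuous Oseen-mild window representative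
  `exists_oseenMild_repr_window` vanishes at one time, and bounded mild solutions are unique,
  `oseenMild_bounded_unique`).

WHAT THIS IS NOT: not Stub QA, not item 18385, no statement about Navier–Stokes regularity.
[folklore; EscauriazaSereginSverak2003 §3; KochNadirashviliSereginSverak2009 L3.1, §4; SereginSverak2009 §2]
-/

noncomputable section

set_option linter.dupNamespace false

namespace Summit.NavierStokesRegularity.NavierStokesRegularity.Theorems.TypeITraceScarL3

open MeasureTheory Set Function Filter Topology TopologicalSpace Metric InnerProductSpace
open Literature.Analysis Literature.Analysis.FluidPDE
open scoped NNReal ENNReal RealInnerProductSpace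

/-! ### The smooth depth representative (local pressure class only) -/
/-- **Smooth representative on a depth strip.**  Let `(u, p)` be in Albritton–Barker's class
Def. 2.1 on every `Q(a)` about the origin and `‖u‖ ≤ L` a.e. on `]a − 1, b[ × ℝ³`, `b ≤ 0`.  Then
on `]a, b[ × ℝ³` the field `u` has a representative `V`: `V = u` a.e., jointly continuous, `C^∞`
slices, all spatial derivatives jointly continuous, and `(V, p)` solves Navier–Stokes in the sense
of distributions there.  (Local representatives on `]a, b[ × B(0, n+1)` by
`exists_smooth_representative_of_locally_bounded` — pressure bound from `p ∈ L^{3/2}(Q(0, A))` —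
glued by `exists_continuousOn_ae_eq_of_locally`.) [cite: SereginSverak2009, §2 p. 8;
EscauriazaSereginSverak2003, §3 (3.26)–(3.30)] -/
theorem exists_depth_representative
    {u : ℝ → EuclideanSpace ℝ (Fin 3) → EuclideanSpace ℝ (Fin 3)}
    {p : ℝ → EuclideanSpace ℝ (Fin 3) → ℝ}
    (hsw : ∀ a : ℝ, 0 < a →
      IsSuitableWeakSolutionInBall a (0 : ℝ × EuclideanSpace ℝ (Fin 3)) u p)
    {a b L : ℝ} (hb : b ≤ 0)
    (hbd : ∀ᵐ z ∂(volume.restrict (Ioo (a - 1) b ×ˢ (univ : Set (EuclideanSpace ℝ (Fin 3))))),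
      ‖u z.1 z.2‖ ≤ L) :
    ∃ V : ℝ → EuclideanSpace ℝ (Fin 3) → EuclideanSpace ℝ (Fin 3),
      uncurry V =ᵐ[volume.restrict (Ioo a b ×ˢ (univ : Set (EuclideanSpace ℝ (Fin 3))))] uncurry u ∧
      ContinuousOn (uncurry V) (Ioo a b ×ˢ (univ : Set (EuclideanSpace ℝ (Fin 3)))) ∧
      (∀ z ∈ Ioo a b ×ˢ (univ : Set (EuclideanSpace ℝ (Fin 3))), ContDiffAt ℝ (⊤ : ℕ∞) (V z.1) z.2) ∧
      (∀ n : ℕ, ContinuousOn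
        (fun z : ℝ × EuclideanSpace ℝ (Fin 3) => iteratedFDeriv ℝ n (V z.1) z.2)
        (Ioo a b ×ˢ (univ : Set (EuclideanSpace ℝ (Fin 3))))) ∧
      IsDistributionalNSSolutionOn
        ⟨Ioo a b ×ˢ (univ : Set (EuclideanSpace ℝ (Fin 3))), isOpen_Ioo.prod isOpen_univ⟩ 1 0 V p := by
  set I : Set ℝ := Ioo a b with hIdef
  set Ω : Set (ℝ × EuclideanSpace ℝ (Fin 3)) := I ×ˢ (univ : Set (EuclideanSpace ℝ (Fin 3)))
    with hΩdef
  have hΩo : IsOpen Ω := isOpen_Ioo.prod isOpen_univ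
  have hdist : ∀ a' : ℝ, 0 < a' → IsDistributionalNSSolutionOn
      (parabolicCylinderOpens a' (0 : ℝ × EuclideanSpace ℝ (Fin 3))) 1 0 u p :=
    fun a' ha' => (hsw a' ha').1.distributional
  -- ### the local representatives on `]a, b[ × B(0, n + 1)`
  have hloc : ∀ n : ℕ, ∃ Vn : ℝ → EuclideanSpace ℝ (Fin 3) → EuclideanSpace ℝ (Fin 3),
      uncurry Vn =ᵐ[volume.restrict (I ×ˢ ball (0 : EuclideanSpace ℝ (Fin 3)) ((n : ℝ) + 1))]
        uncurry u ∧
      ContinuousOn (uncurry Vn) (I ×ˢ ball (0 : EuclideanSpace ℝ (Fin 3)) ((n : ℝ) + 1)) ∧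
      (∀ z ∈ I ×ˢ ball (0 : EuclideanSpace ℝ (Fin 3)) ((n : ℝ) + 1),
        ContDiffAt ℝ (⊤ : ℕ∞) (Vn z.1) z.2) ∧
      (∀ m : ℕ, ContinuousOn
        (fun z : ℝ × EuclideanSpace ℝ (Fin 3) => iteratedFDeriv ℝ m (Vn z.1) z.2)
        (I ×ˢ ball (0 : EuclideanSpace ℝ (Fin 3)) ((n : ℝ) + 1))) := by
    intro n
    -- the big cylinder containing all the local ones, and its pressure bound
    set A : ℝ := (n : ℝ) + 3 + |a| with hA
    have hA1 : (1 : ℝ) ≤ A := by rw [hA]; linarith [abs_nonneg a, (n.cast_nonneg : (0 : ℝ) ≤ n)]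
    have hA0 : 0 < A := by linarith
    have hAsq : A ≤ A ^ 2 := by nlinarith
    have hPfin : ∫⁻ q in parabolicCylinder A (0 : ℝ × EuclideanSpace ℝ (Fin 3)),
        ‖p q.1 q.2‖ₑ ^ (3 / 2 : ℝ) < ⊤ := by
      have h := lintegral_rpow_enorm_lt_top_of_eLpNorm_lt_top (by norm_num)
        (ENNReal.div_lt_top (by norm_num) (by norm_num)).ne (hsw A hA0).2.2.2.eLpNorm_lt_top
      have e : ((3 : ℝ≥0∞) / 2).toReal = (3 / 2 : ℝ) := by
        rw [ENNReal.toReal_div]; norm_num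
      rw [e] at h
      exact h
    set P : ℝ≥0 := (∫⁻ q in parabolicCylinder A (0 : ℝ × EuclideanSpace ℝ (Fin 3)),
        ‖p q.1 q.2‖ₑ ^ (3 / 2 : ℝ)).toNNReal with hP
    have hPeq : (P : ℝ≥0∞) = ∫⁻ q in parabolicCylinder A (0 : ℝ × EuclideanSpace ℝ (Fin 3)),
        ‖p q.1 q.2‖ₑ ^ (3 / 2 : ℝ) := ENNReal.coe_toNNReal hPfin.ne
    -- the local cylinders
    have hcyl : ∀ z ∈ I ×ˢ ball (0 : EuclideanSpace ℝ (Fin 3)) ((n : ℝ) + 1),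
        parabolicCylinder (2 * (1 / 2 : ℝ)) (min (z.1 + (1 / 2 : ℝ) ^ 2) b, z.2) ⊆
          (Ioo (a - 1) b ×ˢ (univ : Set (EuclideanSpace ℝ (Fin 3)))) ∩
            parabolicCylinder A (0 : ℝ × EuclideanSpace ℝ (Fin 3)) := by
      rintro ⟨t, x⟩ ⟨ht, hx⟩ ⟨s, y⟩ hq
      rw [mem_parabolicCylinder] at hq
      obtain ⟨⟨hs1, hs2⟩, hy⟩ := hq
      simp only at hs1 hs2 hy
      rw [mem_ball_zero_iff] at hx
      have hmin1 : a < min (t + (1 / 2 : ℝ) ^ 2) b := lt_min (by linarith [ht.1]) (ht.1.trans ht.2)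
      have hmin2 : min (t + (1 / 2 : ℝ) ^ 2) b ≤ b := min_le_right _ _
      have hy' : ‖y‖ < (n : ℝ) + 2 := by
        calc ‖y‖ = ‖(y - x) + x‖ := by rw [sub_add_cancel]
          _ ≤ ‖y - x‖ + ‖x‖ := norm_add_le _ _
          _ < 2 * (1 / 2 : ℝ) + ((n : ℝ) + 1) := by rw [← dist_eq_norm]; linarith
          _ = (n : ℝ) + 2 := by ring
      refine ⟨⟨⟨by nlinarith, lt_of_lt_of_le hs2 hmin2⟩, mem_univ _⟩, ?_⟩
      rw [mem_parabolicCylinder]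
      simp only [Prod.fst_zero, Prod.snd_zero, zero_sub, dist_zero_right]
      refine ⟨⟨?_, lt_of_lt_of_le (lt_of_lt_of_le hs2 hmin2) hb⟩, by rw [hA]; linarith [abs_nonneg a]⟩
      have h1 : -A ^ 2 ≤ -A := by linarith
      have h2 : -A ≤ a - 1 := by rw [hA]; linarith [neg_abs_le a, (n.cast_nonneg : (0 : ℝ) ≤ n)]
      nlinarith
    have hhyp : ∀ z ∈ I ×ˢ ball (0 : EuclideanSpace ℝ (Fin 3)) ((n : ℝ) + 1),
        IsDistributionalNSSolutionOn
          (parabolicCylinderOpens (2 * (1 / 2 : ℝ)) (min (z.1 + (1 / 2 : ℝ) ^ 2) b, z.2)) 1 0 u p ∧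
        (∀ᵐ q ∂(volume.restrict
          (parabolicCylinder (2 * (1 / 2 : ℝ)) (min (z.1 + (1 / 2 : ℝ) ^ 2) b, z.2))),
            ‖u q.1 q.2‖ ≤ L) ∧
        ∫⁻ q in parabolicCylinder (2 * (1 / 2 : ℝ)) (min (z.1 + (1 / 2 : ℝ) ^ 2) b, z.2),
          ‖p q.1 q.2‖ₑ ^ (3 / 2 : ℝ) ≤ P := by
      intro z hz
      refine ⟨?_, ?_, ?_⟩
      · refine isDistributionalNSSolutionOn_of_forall_cylinder hdist (isOpen_parabolicCylinder _ _) ?_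
        intro q hq
        exact ⟨lt_of_lt_of_le ((hcyl z hz hq).1.1.2) hb, mem_univ _⟩
      · exact ae_restrict_of_ae_restrict_of_subset (fun q hq => (hcyl z hz hq).1) hbd
      · rw [hPeq]
        exact lintegral_mono_set fun q hq => (hcyl z hz hq).2
    obtain ⟨K, Vn, hVu, hVc, hCD, hjc, -⟩ :=
      exists_smooth_representative_of_locally_bounded NSBoundedHigherRegularityBounds_holds
        (w := u) (π := p) (a := a) (b := b) isOpen_ball (M := L) (P := P)
        (ρ := (1 / 2 : ℝ)) (by norm_num) hhyp 4
    exact ⟨Vn, hVu, hVc, hCD, hjc⟩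
  choose Vn hVnu hVnc hVnCD hVnjc using hloc
  -- ### gluing
  set O : ℕ → Set (ℝ × EuclideanSpace ℝ (Fin 3)) :=
    fun n => I ×ˢ ball (0 : EuclideanSpace ℝ (Fin 3)) ((n : ℝ) + 1) with hOdef
  have hOo : ∀ n, IsOpen (O n) := fun n => isOpen_Ioo.prod isOpen_ball
  have hOΩ : ∀ n, O n ⊆ Ω := fun n => prod_mono Subset.rfl (subset_univ _)
  have hmemO : ∀ z ∈ Ω, z ∈ O ⌈‖z.2‖⌉₊ := fun z hz => by
    refine ⟨hz.1, ?_⟩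
    rw [mem_ball_zero_iff]
    exact lt_of_le_of_lt (Nat.le_ceil _) (lt_add_one _)
  obtain ⟨g, hgc, hug⟩ := exists_continuousOn_ae_eq_of_locally (μ := volume) (U := Ω)
    (f := uncurry u) fun z hz => ⟨O ⌈‖z.2‖⌉₊, hOo _, hmemO z hz, hOΩ _, uncurry (Vn ⌈‖z.2‖⌉₊),
      hVnc _, (hVnu _).symm⟩
  set V : ℝ → EuclideanSpace ℝ (Fin 3) → EuclideanSpace ℝ (Fin 3) := fun t x => g (t, x) with hVdef
  have hVg : uncurry V = g := by funext z; rfl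
  -- the glued field agrees with the local representatives on their domains
  have hagree : ∀ n, EqOn (uncurry V) (uncurry (Vn n)) (O n) := by
    intro n
    rw [hVg]
    have h1 : uncurry u =ᵐ[volume.restrict (O n)] g :=
      ae_restrict_of_ae_restrict_of_subset (hOΩ n) hug
    have hae : g =ᵐ[volume.restrict (O n)] uncurry (Vn n) := h1.symm.trans (hVnu n).symm
    exact Measure.eqOn_open_of_ae_eq hae (hOo n) (hgc.mono (hOΩ n)) (hVnc n)
  refine ⟨V, ?_, by rw [hVg]; exact hgc, ?_, ?_, ?_⟩
  · rw [hVg]; exact hug.symm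
  · intro z hz
    exact contDiffAt_of_eqOn (hOo _) (hagree _) (hmemO z hz) (hVnCD _ z (hmemO z hz))
  · intro m
    refine hΩo.continuousOn_iff.2 fun z hz => ?_
    have hn := hmemO z hz
    have hev : (fun w : ℝ × EuclideanSpace ℝ (Fin 3) => iteratedFDeriv ℝ m (V w.1) w.2) =ᶠ[𝓝 z]
        fun w => iteratedFDeriv ℝ m (Vn ⌈‖z.2‖⌉₊ w.1) w.2 := by
      filter_upwards [(hOo _).mem_nhds hn] with w hw
      exact iteratedFDeriv_slice_eq_of_eqOn (hOo _) (hagree _) m hw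
    exact (((hOo _).continuousOn_iff.1 (hVnjc _ m)) hn).congr_of_eventuallyEq hev
  · have hsolu : IsDistributionalNSSolutionOn ⟨Ω, hΩo⟩ 1 0 u p :=
      isDistributionalNSSolutionOn_of_forall_cylinder hdist hΩo
        (prod_mono (fun s hs => lt_of_lt_of_le hs.2 hb) Subset.rfl)
    refine hsolu.congr_ae ?_ (ae_of_all _ fun _ => rfl)
    rw [hVg]
    exact hug

/-! ### Forward uniqueness up to the top time -/
/-- The Oseen–Duhamel term of the zero field vanishes. [folklore] -/
theorem oseenDuhamel_zero_zero (ν s t : ℝ) (x : EuclideanSpace ℝ (Fin 3)) :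
    oseenDuhamel ν s (fun _ _ => (0 : EuclideanSpace ℝ (Fin 3)))
      (fun _ _ => (0 : EuclideanSpace ℝ (Fin 3))) t x = 0 := by
  have hK : ∀ (σ : ℝ) (z b : EuclideanSpace ℝ (Fin 3)), oseenKernel σ z 0 b = 0 := fun σ z b => by
    have h := oseenKernel_smul_left σ z (0 : ℝ) (0 : EuclideanSpace ℝ (Fin 3)) b
    rwa [zero_smul, zero_smul] at h
  simp [oseenDuhamel, hK]

/-- **Forward uniqueness up to the top time.**  Let `(u, p)` be in Albritton–Barker's class on every
`Q(a)`, with `𝐈(ℝ³ × ℝ₋) ≤ I` through a weak gradient `H`, and essentially bounded on every strip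
`]a', c[ × ℝ³`, `c < 0`.  If `u = 0` a.e. on `]t₁, t₂[ × ℝ³` with `t₁ < t₂ ≤ 0`, then `u = 0` a.e.
on `]t₁, 0[ × ℝ³`: on each window `]t₁, c[`, `c < 0`, the (truncated, bounded) field has a
continuous Oseen-mild representative (`exists_oseenMild_repr_window`; the Morrey bound is the
`A`-part of `𝐈`), which vanishes at a time `s₀ ∈ ]t₁, t₂[`, hence solves `v = −B_{s₀}(v, v)` and
coincides with the zero solution (`oseenMild_bounded_unique`).
[cite: KochNadirashviliSereginSverak2009, Lemma 3.1 and §4 (4.3)–(4.4)] -/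
theorem ae_zero_to_top_of_slab_ae_zero
    {u : ℝ → EuclideanSpace ℝ (Fin 3) → EuclideanSpace ℝ (Fin 3)}
    {p : ℝ → EuclideanSpace ℝ (Fin 3) → ℝ}
    {H : ℝ → EuclideanSpace ℝ (Fin 3) → EuclideanSpace ℝ (Fin 3) →L[ℝ] EuclideanSpace ℝ (Fin 3)}
    (hsw : ∀ a : ℝ, 0 < a →
      IsSuitableWeakSolutionInBall a (0 : ℝ × EuclideanSpace ℝ (Fin 3)) u p)
    {I : ℝ} (hI : typeIBound (Iio (0 : ℝ) ×ˢ (univ : Set (EuclideanSpace ℝ (Fin 3)))) u p H ≤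
      ENNReal.ofReal I)
    (hbd : ∀ a' c : ℝ, c < 0 → ∃ L : ℝ,
      ∀ᵐ z ∂(volume.restrict (Ioo a' c ×ˢ (univ : Set (EuclideanSpace ℝ (Fin 3))))), ‖u z.1 z.2‖ ≤ L)
    {t₁ t₂ : ℝ} (h12 : t₁ < t₂) (ht₂ : t₂ ≤ 0)
    (hzero : ∀ᵐ z ∂(volume.restrict (Ioo t₁ t₂ ×ˢ (univ : Set (EuclideanSpace ℝ (Fin 3))))),
      uncurry u z = 0) :
    ∀ᵐ z ∂(volume.restrict (Ioo t₁ 0 ×ˢ (univ : Set (EuclideanSpace ℝ (Fin 3))))),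
      uncurry u z = 0 := by
  have hslab : IsSuitableWeakSolutionOn (slab (EuclideanSpace ℝ (Fin 3)) (Iio 0) isOpen_Iio) 1 0 u p :=
    ESSBlowup.isSuitableWeakSolutionOn_halfspace hsw
  -- ### the windows `]t₁, c n[`, `c n = -1/(n+1)`
  set c : ℕ → ℝ := fun n => -(1 / ((n : ℝ) + 1)) with hc
  have hc0 : ∀ n, c n < 0 := fun n => by
    rw [hc]; dsimp only; rw [neg_lt_zero]; positivity
  have hcover : Ioo t₁ 0 ×ˢ (univ : Set (EuclideanSpace ℝ (Fin 3))) ⊆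
      ⋃ n : ℕ, Ioo t₁ (c n) ×ˢ (univ : Set (EuclideanSpace ℝ (Fin 3))) := by
    rintro ⟨s, y⟩ ⟨hs, -⟩
    obtain ⟨n, hn⟩ := exists_nat_gt (1 / (-s))
    refine mem_iUnion.2 ⟨n, ⟨hs.1, ?_⟩, mem_univ _⟩
    have hs0 : 0 < -s := by linarith [hs.2]
    have hn1 : 1 / (-s) < (n : ℝ) + 1 := by linarith
    rw [hc]; dsimp only
    rw [lt_neg, one_div_lt (by positivity) hs0]
    exact hn1
  refine ae_restrict_of_ae_restrict_of_subset hcover ?_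
  rw [ae_restrict_iUnion_iff]
  intro n
  -- ### one window
  by_cases hcn : c n ≤ t₂
  · exact ae_restrict_of_ae_restrict_of_subset (prod_mono (Ioo_subset_Ioo_right hcn) Subset.rfl) hzero
  push Not at hcn
  set W : Set ℝ := Ioo t₁ (c n) with hW
  have hWo : IsOpen W := isOpen_Ioo
  have h1c : t₁ < c n := h12.trans_le hcn.le
  -- the bound and the truncation
  obtain ⟨L, hL⟩ := hbd t₁ (c n) (hc0 n)
  set L' : ℝ := max L 0 with hL'
  have hL'0 : 0 ≤ L' := le_max_right _ _
  classical
  set ut : ℝ → EuclideanSpace ℝ (Fin 3) → EuclideanSpace ℝ (Fin 3) :=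
    fun t x => if ‖u t x‖ ≤ L' then u t x else 0 with hut
  have hut_bd : ∀ t x, ‖ut t x‖ ≤ L' := fun t x => by
    simp only [hut]
    split_ifs with h
    · exact h
    · simpa using hL'0
  have hut_ae : ∀ᵐ z ∂(volume.restrict (W ×ˢ (univ : Set (EuclideanSpace ℝ (Fin 3))))),
      uncurry u z = uncurry ut z := by
    filter_upwards [hL] with z hz
    rcases z with ⟨t, x⟩
    show u t x = ut t x
    simp only [hut, if_pos (show ‖u t x‖ ≤ L' from hz.trans (le_max_left _ _))]
  have hswW : IsSuitableWeakSolutionOn (slab (EuclideanSpace ℝ (Fin 3)) W hWo) 1 0 ut p := by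
    have h := hslab.of_le (slab_mono (X := EuclideanSpace ℝ (Fin 3)) (hI := hWo) (hJ := isOpen_Iio)
      (fun t ht => ht.2.trans (hc0 n)))
    refine h.congr_ae ?_ (ae_of_all _ fun _ => rfl)
    rw [coe_slab]
    exact hut_ae
  -- the Morrey bound on the window, transported to the truncation
  obtain ⟨m₀, hm₀⟩ := exists_nat_ge (-t₁)
  set I' : ℝ := max I 0 with hI'
  have hI'0 : 0 ≤ I' := le_max_right _ _
  have hIle' : typeIBound (Iio (0 : ℝ) ×ˢ (univ : Set (EuclideanSpace ℝ (Fin 3)))) u p H ≤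
      ENNReal.ofReal I' := hI.trans (ENNReal.ofReal_le_ofReal (le_max_left _ _))
  have hslice : ∀ᵐ t ∂(volume.restrict W), u t =ᵐ[volume] ut t := by
    have h1 : ∀ᵐ z ∂((volume.restrict W).prod (volume : Measure (EuclideanSpace ℝ (Fin 3)))),
        uncurry u z = uncurry ut z := by
      rw [Measure.restrict_prod_eq_prod_univ, ← Measure.volume_eq_prod]
      exact hut_ae
    filter_upwards [Measure.ae_ae_of_ae_prod h1] with t ht
    filter_upwards [ht] with x hx
    exact hx
  have hMor : ∀ᵐ t ∂(volume.restrict W), ∀ m : ℕ, m₀ + 1 ≤ m →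
      ∫⁻ y in ball (0 : EuclideanSpace ℝ (Fin 3)) m, ‖ut t y‖ₑ ^ 2 ≤ ENNReal.ofReal (I' * m) := by
    have hall : ∀ᵐ t ∂(volume.restrict W), ∀ m : ℕ, m₀ + 1 ≤ m →
        ∫⁻ y in ball (0 : EuclideanSpace ℝ (Fin 3)) m, ‖u t y‖ₑ ^ 2 ≤ ENNReal.ofReal (I' * m) := by
      rw [ae_all_iff]
      intro m
      by_cases hm : m₀ + 1 ≤ m
      · have hm' : (m₀ : ℝ) + 1 ≤ m := by exact_mod_cast hm
        have hmpos : (0 : ℝ) < m := by linarith [(m₀.cast_nonneg : (0 : ℝ) ≤ m₀)]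
        have hsub : W ⊆ Ioo (-(m : ℝ) ^ 2) 0 := fun s hs =>
          ⟨by nlinarith [hs.1, (m₀.cast_nonneg : (0 : ℝ) ≤ m₀)], hs.2.trans (hc0 n)⟩
        filter_upwards [ae_restrict_of_ae_restrict_of_subset hsub
          (ae_lintegral_ball_sq_le_of_typeIBound hIle' hmpos)] with t ht _ using ht
      · exact Eventually.of_forall fun t h => absurd h hm
    filter_upwards [hall, hslice] with t ht hts m hm
    have e : ∫⁻ y in ball (0 : EuclideanSpace ℝ (Fin 3)) m, ‖ut t y‖ₑ ^ 2 =
        ∫⁻ y in ball (0 : EuclideanSpace ℝ (Fin 3)) m, ‖u t y‖ₑ ^ 2 :=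
      lintegral_congr_ae (ae_restrict_of_ae (hts.mono fun y hy => by
        show ‖ut t y‖ₑ ^ 2 = ‖u t y‖ₑ ^ 2
        rw [hy]))
    rw [e]
    exact ht m hm
  -- ### the Oseen-mild representative of the window
  obtain ⟨v, hvc, -, hvmild, hvae⟩ := exists_oseenMild_repr_window h1c hswW
    (fun t _ x => hut_bd t x) hI'0 hMor
  have huv : ∀ᵐ z ∂(volume.restrict (W ×ˢ (univ : Set (EuclideanSpace ℝ (Fin 3))))),
      uncurry u z = uncurry v z := by
    filter_upwards [hut_ae, hvae] with z h1 h2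
    rw [h1, h2]
  -- `v` is bounded everywhere on the window
  have hvbd : ∀ t ∈ W, ∀ x, ‖v t x‖ ≤ L' := by
    have hopen : IsOpen {z : ℝ × EuclideanSpace ℝ (Fin 3) |
        z ∈ W ×ˢ (univ : Set (EuclideanSpace ℝ (Fin 3))) ∧ L' < ‖uncurry v z‖} :=
      hvc.norm.isOpen_inter_preimage (hWo.prod isOpen_univ) isOpen_Ioi
    have hnull : volume {z : ℝ × EuclideanSpace ℝ (Fin 3) |
        z ∈ W ×ˢ (univ : Set (EuclideanSpace ℝ (Fin 3))) ∧ L' < ‖uncurry v z‖} = 0 := by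
      have hae : ∀ᵐ z ∂(volume.restrict (W ×ˢ (univ : Set (EuclideanSpace ℝ (Fin 3))))),
          ‖uncurry v z‖ ≤ L' := by
        filter_upwards [hvae] with z hz
        rw [← hz]
        exact hut_bd z.1 z.2
      rw [ae_restrict_iff' (hWo.measurableSet.prod MeasurableSet.univ), ae_iff] at hae
      refine measure_mono_null (fun z hz => ?_) hae
      simp only [mem_setOf_eq, not_le, Classical.not_imp]
      exact ⟨hz.1, hz.2⟩
    have hempty := (hopen.measure_eq_zero_iff volume).1 hnull
    intro t ht x
    by_contra h
    have hmem : ((t, x) : ℝ × EuclideanSpace ℝ (Fin 3)) ∈ {z : ℝ × EuclideanSpace ℝ (Fin 3) |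
        z ∈ W ×ˢ (univ : Set (EuclideanSpace ℝ (Fin 3))) ∧ L' < ‖uncurry v z‖} :=
      ⟨⟨ht, mem_univ _⟩, not_le.1 h⟩
    rw [hempty] at hmem
    exact hmem
  -- `v` vanishes on `]t₁, t₂[ × ℝ³`
  have h12W : Ioo t₁ t₂ ×ˢ (univ : Set (EuclideanSpace ℝ (Fin 3))) ⊆
      W ×ˢ (univ : Set (EuclideanSpace ℝ (Fin 3))) :=
    prod_mono (Ioo_subset_Ioo_right hcn.le) Subset.rfl
  have hv12 : EqOn (uncurry v) (fun _ => 0) (Ioo t₁ t₂ ×ˢ (univ : Set (EuclideanSpace ℝ (Fin 3)))) := by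
    have hae : uncurry v =ᵐ[volume.restrict (Ioo t₁ t₂ ×ˢ (univ : Set (EuclideanSpace ℝ (Fin 3))))]
        fun _ => 0 := by
      filter_upwards [hzero, ae_restrict_of_ae_restrict_of_subset h12W huv] with z h1 h2
      rw [← h2, h1]
    exact Measure.eqOn_open_of_ae_eq hae (isOpen_Ioo.prod isOpen_univ) (hvc.mono h12W)
      continuousOn_const
  set s₀ : ℝ := (t₁ + t₂) / 2 with hs₀
  have hs₀1 : t₁ < s₀ := by rw [hs₀]; linarith
  have hs₀2 : s₀ < t₂ := by rw [hs₀]; linarith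
  have hvs₀ : v s₀ = fun _ => 0 := by
    funext x
    exact hv12 (show ((s₀, x) : ℝ × EuclideanSpace ℝ (Fin 3)) ∈ Ioo t₁ t₂ ×ˢ univ from
      ⟨⟨hs₀1, hs₀2⟩, mem_univ _⟩)
  -- ### uniqueness of bounded mild solutions on `]s₀, c n[`
  have hsc : Ioo s₀ (c n) ⊆ W := Ioo_subset_Ioo_left hs₀1.le
  have huniq := oseenMild_bounded_unique (E := EuclideanSpace ℝ (Fin 3)) (ν := 1) (M := L')
    (s := s₀) (T := c n) (U := fun _ _ => (0 : EuclideanSpace ℝ (Fin 3))) (u := v)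
    (v := fun _ _ => (0 : EuclideanSpace ℝ (Fin 3))) one_pos hL'0
    ((hvc.mono (prod_mono hsc Subset.rfl)).aestronglyMeasurable
      (measurableSet_Ioo.prod MeasurableSet.univ))
    aestronglyMeasurable_const
    (fun τ hτ y => hvbd τ (hsc hτ) y) (fun τ _ y => by simpa using hL'0)
    (fun t ht => Eventually.of_forall fun x => by
      have h := hvmild s₀ t hs₀1 ht.1 ht.2 x
      rw [h, hvs₀, UnboundedOperators.heatExtension_zero_fun]
      simp)
    (fun t _ => Eventually.of_forall fun x => by
      simp [oseenDuhamel_zero_zero])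
  -- `v(t) = 0` everywhere for `t ∈ ]s₀, c n[`
  have hvzero : ∀ t ∈ Ioo s₀ (c n), v t = fun _ => 0 := by
    intro t ht
    have hcont : Continuous (v t) :=
      (hvc.comp_continuous (f := fun x : EuclideanSpace ℝ (Fin 3) => (t, x)) (by fun_prop)
        fun x => ⟨hsc ht, mem_univ _⟩)
    exact (Continuous.ae_eq_iff_eq volume hcont continuous_const).1 (huniq t ht)
  -- ### conclusion on the window
  filter_upwards [huv, ae_restrict_mem (measurableSet_Ioo.prod MeasurableSet.univ)] with z hz hzW
  rw [hz]
  rcases z with ⟨t, x⟩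
  obtain ⟨⟨ht1, ht2⟩, -⟩ := hzW
  by_cases ht : t < t₂
  · exact hv12 ⟨⟨ht1, ht⟩, mem_univ x⟩
  · push Not at ht
    have h := hvzero t ⟨hs₀2.trans_le ht, ht2⟩
    show v t x = 0
    rw [h]

end Summit.NavierStokesRegularity.NavierStokesRegularity.Theorems.TypeITraceScarL3

end
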